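import Summits.Schanuel.Schanuel.Theorems.ZilberEacGraphRamifiedBranch
import Summits.Schanuel.Schanuel.Theorems.ZilberEacGraphThreePointEdge
import HarnessLib

/-!
# The equimodular class, LXV: cycles at infinity from ONE NEWTON–PUISEUX STEP AT INFINITY — top-row
# roots with `T₁(θ) = 0`; the example `{x₁ = p(x₀), x₀²(y₀ - 1)² + y₀ = 0}`

HONEST FRAMING.  Cell `pub-schanuel` (Zilber's Exponential-Algebraic Closedness, case ladder;
host summit Schanuel), seat 2, gen 26.  File LXIII decides density along ANY analytically
parametrised cycle `x₀ = s^{-k}`, `y₀ = ψ(s)` at infinity, and file LIII produces such a cycle through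
a top-row root `θ` with `T₁(θ) ≠ 0`.  This file produces cycles from an arbitrary Newton–Puiseux step
AT INFINITY: **`exists_fibreCycle_newton`** — if `(t^k)^N Q(t^{-k}, θ + t^μ w) = t^ν Q̃(t, w)` for
`t, w ≠ 0` (`k, μ ≥ 1`) and `Q̃(0, ·)` has a simple nonzero root, then there is `ψ` analytic at `0`,
`ψ(0) = θ`, `ψ ≢ θ`, with `Q(s^{-k}, ψ(s)) = 0` for small `s ≠ 0` (the branch of `Q̃ = 0` through
`(0, w₀)` by the implicit function theorem, `ψ = θ + t^μ w(t)`).  Corollaries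
**`unprojectedDense_graph_infinityNewton_unramified/_newtonBranch`** (such a datum at a nonzero
`θ`, plus an unramified or Newton-simple zero or pole ⟹ DENSE over every polynomial graph of degree
`≥ 2`), and the example **`unprojectedDensityQuestion_graph_tangentDoubleRootFibre`**:
`{x₁ = p(x₀), x₀²(y₀ - 1)² + y₀ = 0}` — top row `(X - 1)²` with `T₁ ≡ 0` (outside file LXIII's
corollaries: two branches `y₀ = 1 ± i/x₀ + …` TANGENT at infinity, `k = 1`, edge polynomial
`w² + 1`) — is in Mantova–Masser's case and DENSE for every `p` of degree `≥ 2`.  Complete classes of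
instances of an OPEN question (Mantova–Masser, PLMS 2024 §1 p. 5); EC(3,2) OPEN; NOT Schanuel's
conjecture (neither used nor implied); EAC ⇏ SC.
-/

noncomputable section

open Filter Topology Set Complex MvPolynomial
open Literature.NumberTheory.Transcendental Literature.ModelTheory.Zilber
open Literature.ModelTheory.ExponentialFields

set_option linter.dupNamespace false

namespace Summit.Schanuel.Schanuel.Theorems

/-! ## Part A. A cycle at infinity from a Newton–Puiseux datum at infinity -/

/-- **A cycle of branches at infinity from one Newton–Puiseux step at infinity.**  See the module
docstring. [folklore (Newton–Puiseux), made concrete] (new in this form) -/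
theorem exists_fibreCycle_newton (Q : Polynomial (Polynomial ℂ)) (N : ℕ) (θ : ℂ) {k μ ν : ℕ}
    (hμ : 1 ≤ μ) (Qt : Polynomial (Polynomial ℂ)) {w₀ : ℂ} (hw₀ : w₀ ≠ 0)
    (hroot : (Qt.map (Polynomial.evalRingHom 0)).IsRoot w₀)
    (hsimple : ¬ ((Polynomial.derivative Qt).map (Polynomial.evalRingHom 0)).IsRoot w₀)
    (hid : ∀ t w : ℂ, t ≠ 0 → w ≠ 0 →
      (t ^ k) ^ N * (Q.map (Polynomial.evalRingHom (t ^ k)⁻¹)).eval (θ + t ^ μ * w) =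
        t ^ ν * (Qt.map (Polynomial.evalRingHom t)).eval w) :
    ∃ ψ : ℂ → ℂ, AnalyticAt ℂ ψ 0 ∧ ψ 0 = θ ∧ (¬ ∀ᶠ s in 𝓝 (0 : ℂ), ψ s = θ) ∧
      ∀ᶠ s in 𝓝[≠] (0 : ℂ), (Q.map (Polynomial.evalRingHom (s ^ k)⁻¹)).eval (ψ s) = 0 := by
  obtain ⟨w, hwan, hw0, hwroot⟩ := exists_branchAt Qt hroot hsimple
  have hwne : ∀ᶠ t in 𝓝 (0 : ℂ), w t ≠ 0 := hwan.continuousAt.eventually_ne (by rw [hw0]; exact hw₀)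
  refine ⟨fun t => θ + t ^ μ * w t, analyticAt_const.add ((analyticAt_id.pow μ).mul hwan),
    by simp [zero_pow (by omega : μ ≠ 0)], ?_, ?_⟩
  · intro hzero
    have h2 : ∀ᶠ t in 𝓝[≠] (0 : ℂ), False := by
      filter_upwards [self_mem_nhdsWithin, nhdsWithin_le_nhds hzero, nhdsWithin_le_nhds hwne]
        with t (ht : t ≠ 0) hψt hwt
      have : t ^ μ * w t = 0 := by simpa using hψt
      exact (mul_ne_zero (pow_ne_zero _ ht) hwt) this
    exact h2.exists.elim fun _ h => h
  · filter_upwards [self_mem_nhdsWithin, nhdsWithin_le_nhds hwroot, nhdsWithin_le_nhds hwne]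
      with t (ht : t ≠ 0) hQt hwt
    have h := hid t (w t) ht hwt
    rw [hQt, mul_zero] at h
    exact (mul_eq_zero.1 h).resolve_left (pow_ne_zero _ (pow_ne_zero _ ht))

/-! ## Part B. Surface theorems from a Newton–Puiseux datum at infinity -/

/-- **Density from a Newton–Puiseux step at infinity and an unramified zero or pole.**
`P` irreducible with rows `Q` of positive `t`-degree; a datum
`(t^k)^N Q(t^{-k}, θ + t^μ w) = t^ν Q̃(t, w)` at a nonzero `θ` with a simple nonzero root of `Q̃(0, ·)`;
an unramified zero or (`q₀ ≠ 0`) pole; `deg p ≥ 2`.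
[cite: MantovaMasser2023, §1 Further remarks, p. 5 (the question, open in general)] (new) -/
theorem unprojectedDense_graph_infinityNewton_unramified (Q : Polynomial (Polynomial ℂ))
    {P : MvPolynomial (Fin 2) ℂ}
    (hP : ∀ x y : ℂ, MvPolynomial.eval ![x, y] P = (Q.map (Polynomial.evalRingHom x)).eval y)
    (hirr : Irreducible P) (hQ1 : Q.natDegree ≠ 0) (N : ℕ) {θ : ℂ} (hθ0 : θ ≠ 0) {k μ ν : ℕ}
    (hk : 1 ≤ k) (hμ : 1 ≤ μ) (Qt : Polynomial (Polynomial ℂ)) {w₀ : ℂ} (hw₀ : w₀ ≠ 0)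
    (hroot : (Qt.map (Polynomial.evalRingHom 0)).IsRoot w₀)
    (hsimple : ¬ ((Polynomial.derivative Qt).map (Polynomial.evalRingHom 0)).IsRoot w₀)
    (hid : ∀ t w : ℂ, t ≠ 0 → w ≠ 0 →
      (t ^ k) ^ N * (Q.map (Polynomial.evalRingHom (t ^ k)⁻¹)).eval (θ + t ^ μ * w) =
        t ^ ν * (Qt.map (Polynomial.evalRingHom t)).eval w)
    (hpt : (∃ a : ℂ, (Q.coeff 0).IsRoot a ∧ ¬ (Q.coeff 1).IsRoot a) ∨
      (Q.coeff 0 ≠ 0 ∧ ∃ a : ℂ, (Q.coeff Q.natDegree).IsRoot a ∧ ¬ (Q.coeff (Q.natDegree - 1)).IsRoot a))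
    (p : Polynomial ℂ) (hd : 2 ≤ p.natDegree) :
    UnprojectedDense {w : Fin 2 ⊕ Fin 2 → ℂ | w (Sum.inl 1) = p.eval (w (Sum.inl 0)) ∧
      MvPolynomial.eval ![w (Sum.inl 0), w (Sum.inr 0)] P = 0} := by
  obtain ⟨ψ, hψ, hψ0, -, hbranch⟩ := exists_fibreCycle_newton Q N θ hμ Qt hw₀ hroot hsimple hid
  exact unprojectedDense_graph_cycle_unramified Q hP hirr hQ1 hk hψ hθ0 hψ0 hbranch hpt p hd

/-- **Density from a Newton–Puiseux step at infinity and a simple root of `q₀`.**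
[cite: MantovaMasser2023, §1 Further remarks, p. 5 (the question, open in general)] (new) -/
theorem unprojectedDense_graph_infinityNewton_simpleZero (Q : Polynomial (Polynomial ℂ))
    {P : MvPolynomial (Fin 2) ℂ}
    (hP : ∀ x y : ℂ, MvPolynomial.eval ![x, y] P = (Q.map (Polynomial.evalRingHom x)).eval y)
    (hirr : Irreducible P) (hQ1 : Q.natDegree ≠ 0) (N : ℕ) {θ : ℂ} (hθ0 : θ ≠ 0) {k μ ν : ℕ}
    (hk : 1 ≤ k) (hμ : 1 ≤ μ) (Qt : Polynomial (Polynomial ℂ)) {w₀ : ℂ} (hw₀ : w₀ ≠ 0)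
    (hroot : (Qt.map (Polynomial.evalRingHom 0)).IsRoot w₀)
    (hsimple : ¬ ((Polynomial.derivative Qt).map (Polynomial.evalRingHom 0)).IsRoot w₀)
    (hid : ∀ t w : ℂ, t ≠ 0 → w ≠ 0 →
      (t ^ k) ^ N * (Q.map (Polynomial.evalRingHom (t ^ k)⁻¹)).eval (θ + t ^ μ * w) =
        t ^ ν * (Qt.map (Polynomial.evalRingHom t)).eval w)
    {a : ℂ} (ha : (Q.coeff 0).IsRoot a) (ha' : ¬ (Polynomial.derivative (Q.coeff 0)).IsRoot a)
    (p : Polynomial ℂ) (hd : 2 ≤ p.natDegree) :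
    UnprojectedDense {w : Fin 2 ⊕ Fin 2 → ℂ | w (Sum.inl 1) = p.eval (w (Sum.inl 0)) ∧
      MvPolynomial.eval ![w (Sum.inl 0), w (Sum.inr 0)] P = 0} := by
  have hQirr : Irreducible Q := (irreducible_rows_iff hP).1 hirr
  obtain ⟨ψ, hψ, hψ0, -, hbranch⟩ := exists_fibreCycle_newton Q N θ hμ Qt hw₀ hroot hsimple hid
  obtain ⟨e, Qt', w₁, he1, hw₁, hroot', hsimple', hid', -, -⟩ :=
    exists_newtonDatum_simpleZero Q (exists_coeff_not_isRoot_of_irreducible hQirr hQ1 a) ha ha'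
  exact unprojectedDense_graph_cycle_newtonBranch Q hP hirr hQ1 hk hψ hθ0 hψ0 hbranch a (ν := e) he1 le_rfl
    Qt' hw₁ hroot' hsimple' (Or.inl hid') p hd

/-! ## Part C. The example with tangent branches at infinity -/

/-- `x₀²(y₀ - 1)² + y₀` is irreducible (a quadratic in `x₀` over `ℂ[y₀]` with coprime extreme
coefficients `(y₀ - 1)²`, `y₀` and discriminant `-4y₀(y₀ - 1)²`, not a square). [folklore] -/
theorem irreducible_tangentDoubleRootFibre :
    Irreducible (X 0 ^ 2 * (X 1 - 1) ^ 2 + X 1 : MvPolynomial (Fin 2) ℂ) := by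
  classical
  set P : MvPolynomial (Fin 2) ℂ := X 0 ^ 2 * (X 1 - 1) ^ 2 + X 1 with hPdef
  set A : Polynomial ℂ := (Polynomial.X - 1) ^ 2 with hA
  set Cc : Polynomial ℂ := Polynomial.X with hCc
  set Q' : Polynomial (Polynomial ℂ) := Polynomial.C A * Polynomial.X ^ 2 + Polynomial.C 0 * Polynomial.X +
    Polynomial.C Cc with hQ'
  set Ps : MvPolynomial (Fin 2) ℂ := MvPolynomial.rename (Equiv.swap (0 : Fin 2) 1) P with hPs
  have hPsQ : ∀ x y : ℂ, MvPolynomial.eval ![x, y] Ps = (Q'.map (Polynomial.evalRingHom x)).eval y := by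
    intro x y
    rw [hPs, MvPolynomial.eval_rename]
    have e : (![x, y] : Fin 2 → ℂ) ∘ (Equiv.swap (0 : Fin 2) 1) = ![y, x] := by
      funext i; fin_cases i <;> rfl
    rw [e, hPdef, hQ']
    simp [hA, hCc]
    ring
  have hA0 : A ≠ 0 := by rw [hA]; exact pow_ne_zero _ (Polynomial.X_sub_C_ne_zero 1)
  have hAC : IsCoprime A Cc := ⟨1, 2 - Polynomial.X, by rw [hA, hCc]; ring⟩
  have hdisc : ∀ s : Polynomial ℂ, (0 : Polynomial ℂ) ^ 2 - 4 * A * Cc ≠ s ^ 2 := by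
    intro s hs
    have hD : (0 : Polynomial ℂ) ^ 2 - 4 * A * Cc =
        -4 * Polynomial.X ^ 3 + 8 * Polynomial.X ^ 2 - 4 * Polynomial.X := by
      rw [hA, hCc]; ring
    have hroot : ((0 : Polynomial ℂ) ^ 2 - 4 * A * Cc).IsRoot 0 := by
      rw [hD]; simp [Polynomial.IsRoot]
    have hder : ¬ (Polynomial.derivative ((0 : Polynomial ℂ) ^ 2 - 4 * A * Cc)).IsRoot 0 := by
      rw [hD]; simp [Polynomial.IsRoot, Polynomial.derivative_pow]
    have hodd := odd_rootMultiplicity_of_simple_root hroot hder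
    have h := sq_mul_ne_sq_of_odd_rootMultiplicity (P₁ := 1) (P₂ := s) hodd one_ne_zero
    rw [one_pow, mul_one] at h
    exact h hs
  have hQ'irr : Irreducible Q' := irreducible_quadratic_of_disc_ne_sq hA0 hAC hdisc
  have hPsirr : Irreducible Ps := (irreducible_rows_iff hPsQ).2 hQ'irr
  have : Ps = MvPolynomial.renameEquiv ℂ (Equiv.swap (0 : Fin 2) 1) P := rfl
  rw [this] at hPsirr
  exact (MulEquiv.irreducible_iff (MvPolynomial.renameEquiv ℂ (Equiv.swap (0 : Fin 2) 1))).1 hPsirr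

/-- **`{x₁ = p(x₀), x₀²(y₀ - 1)² + y₀ = 0}` is in Mantova–Masser's case and DENSE** for every `p` of
degree `≥ 2`: top row `(X - 1)²` with next row `T₁ ≡ 0` (two branches `y₀ = 1 ± i/x₀ + …` tangent at
infinity: the Newton datum at infinity `t² Q(1/t, 1 + tw) = t²(w² + tw + 1)`, `w₀ = i`), and an
unramified zero at `x₀ = 0` (`q₀ = x₀²`, `q₁(0) = 1`).
[cite: MantovaMasser2023, §1 Further remarks, p. 5 (the question, open in general)] (new) -/
theorem unprojectedDensityQuestion_graph_tangentDoubleRootFibre (p : Polynomial ℂ) (hd : 2 ≤ p.natDegree) :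
    MMCaseDimPiOneFree {w : Fin 2 ⊕ Fin 2 → ℂ | w (Sum.inl 1) = p.eval (w (Sum.inl 0)) ∧
      w (Sum.inl 0) ^ 2 * (w (Sum.inr 0) - 1) ^ 2 + w (Sum.inr 0) = 0} ∧
    UnprojectedDense {w : Fin 2 ⊕ Fin 2 → ℂ | w (Sum.inl 1) = p.eval (w (Sum.inl 0)) ∧
      w (Sum.inl 0) ^ 2 * (w (Sum.inr 0) - 1) ^ 2 + w (Sum.inr 0) = 0} := by
  classical
  set P : MvPolynomial (Fin 2) ℂ := X 0 ^ 2 * (X 1 - 1) ^ 2 + X 1 with hPdef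
  have hset : {w : Fin 2 ⊕ Fin 2 → ℂ | w (Sum.inl 1) = p.eval (w (Sum.inl 0)) ∧
      w (Sum.inl 0) ^ 2 * (w (Sum.inr 0) - 1) ^ 2 + w (Sum.inr 0) = 0} =
      {w : Fin 2 ⊕ Fin 2 → ℂ | w (Sum.inl 1) = p.eval (w (Sum.inl 0)) ∧
        MvPolynomial.eval ![w (Sum.inl 0), w (Sum.inr 0)] P = 0} := by
    ext w
    simp only [Set.mem_setOf_eq, hPdef, MvPolynomial.eval_X, map_add, map_mul, map_pow, map_sub,
      map_one, Matrix.cons_val_zero, Matrix.cons_val_one]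
  rw [hset]
  have hirr : Irreducible P := irreducible_tangentDoubleRootFibre
  -- the rows: `Q = s²·(t - 1)² + t`
  set Q : Polynomial (Polynomial ℂ) :=
    Polynomial.C (Polynomial.X ^ 2) * (Polynomial.X - 1) ^ 2 + Polynomial.X with hQdef
  have hP : ∀ x y : ℂ, MvPolynomial.eval ![x, y] P = (Q.map (Polynomial.evalRingHom x)).eval y := by
    intro x y
    rw [hQdef]
    simp [hPdef]
  have hQexp : Q = Polynomial.C (Polynomial.X ^ 2) * Polynomial.X ^ 2 +
      Polynomial.C (1 - 2 * Polynomial.X ^ 2) * Polynomial.X + Polynomial.C (Polynomial.X ^ 2) := by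
    rw [hQdef, map_sub, map_one, map_mul, map_pow, map_ofNat]
    ring
  have hcoefQ : ∀ j, Q.coeff j = if j = 2 then Polynomial.X ^ 2 else if j = 1 then 1 - 2 * Polynomial.X ^ 2
      else if j = 0 then Polynomial.X ^ 2 else 0 := by
    intro j
    rw [hQexp]
    simp only [Polynomial.coeff_add, Polynomial.coeff_C_mul, Polynomial.coeff_X_pow, Polynomial.coeff_X,
      Polynomial.coeff_C]
    rcases j with _ | _ | _ | j <;> simp
  have hQdeg : Q.natDegree = 2 := by
    rw [hQexp]; exact Polynomial.natDegree_quadratic (pow_ne_zero _ Polynomial.X_ne_zero)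
  have hQ1 : Q.natDegree ≠ 0 := by rw [hQdeg]; norm_num
  -- the Newton datum at infinity: `t² Q(1/t, 1 + t w) = t² (w² + t w + 1)`
  set Qt : Polynomial (Polynomial ℂ) := Polynomial.X ^ 2 + Polynomial.C Polynomial.X * Polynomial.X + 1
    with hQt
  have hid : ∀ t w : ℂ, t ≠ 0 → w ≠ 0 →
      (t ^ 1) ^ 2 * (Q.map (Polynomial.evalRingHom (t ^ 1)⁻¹)).eval (1 + t ^ 1 * w) =
        t ^ 2 * (Qt.map (Polynomial.evalRingHom t)).eval w := by
    intro t w ht _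
    rw [hQdef, hQt]
    simp only [pow_one, Polynomial.map_add, Polynomial.map_mul, Polynomial.map_pow, Polynomial.map_sub,
      Polynomial.map_one, Polynomial.map_C, Polynomial.map_X, Polynomial.coe_evalRingHom,
      Polynomial.eval_add, Polynomial.eval_mul, Polynomial.eval_pow, Polynomial.eval_sub, Polynomial.eval_one,
      Polynomial.eval_C, Polynomial.eval_X]
    field_simp
    ring
  have hroot : (Qt.map (Polynomial.evalRingHom 0)).IsRoot I := by
    rw [hQt]; simp [Polynomial.IsRoot]
  have hsimple : ¬ ((Polynomial.derivative Qt).map (Polynomial.evalRingHom 0)).IsRoot I := by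
    rw [hQt]
    simp [Polynomial.IsRoot, Polynomial.derivative_pow, I_ne_zero]
  refine ⟨mmCase_fibreCurveSurface p hd hirr ?_, ?_⟩
  · -- infinitely many `t` with a nonzero fibre point: every `t ≠ 0`
    refine (Set.finite_singleton (0 : ℂ)).infinite_compl.mono ?_
    intro t ht
    simp only [Set.mem_compl_iff, Set.mem_singleton_iff] at ht
    set q : Polynomial ℂ := Polynomial.C (t ^ 2) * Polynomial.X ^ 2 + Polynomial.C (1 - 2 * t ^ 2) * Polynomial.X +
      Polynomial.C (t ^ 2) with hq
    have hqdeg : 0 < q.degree := by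
      rw [hq, Polynomial.degree_quadratic (pow_ne_zero _ ht)]; norm_num
    obtain ⟨y, hy⟩ := Complex.exists_root hqdeg
    have hy' : t ^ 2 * (y - 1) ^ 2 + y = 0 := by
      have := hy.eq_zero
      simp only [hq, Polynomial.eval_add, Polynomial.eval_mul, Polynomial.eval_C, Polynomial.eval_pow,
        Polynomial.eval_X] at this
      linear_combination this
    refine ⟨y, ?_, ?_⟩
    · rintro rfl
      apply ht
      have h : t ^ 2 = 0 := by simpa using hy'
      exact pow_eq_zero_iff (two_ne_zero) |>.1 h
    · simp only [hPdef, map_add, map_mul, map_pow, map_sub, map_one, MvPolynomial.eval_X,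
        Matrix.cons_val_zero, Matrix.cons_val_one]
      exact hy'
  · refine unprojectedDense_graph_infinityNewton_unramified Q hP hirr hQ1 2 one_ne_zero (k := 1) (μ := 1)
      (ν := 2) le_rfl le_rfl Qt I_ne_zero hroot hsimple hid (Or.inl ⟨0, ?_, ?_⟩) p hd
    · rw [hcoefQ]; simp
    · rw [hcoefQ]; simp

end Summit.Schanuel.Schanuel.Theorems
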